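import Summits.Ventures.PercRepro.C041RcPortTheoremR

/-!
# The per-colouring sum `F(O)`, the interior blue edges `B(O)` and mine-3's CONJECTURE (O-CUBE), with its base case
(p6, gen 24; C-041.md §5 (b)–(c))

Setting of `C041RcPortTheoremR`.  `F O` = the sum of `3g − 2` over ALL `(D,A)` sources with bare colouring `O`
(`sumF`); `B(O)` = the blue bare edges inside the terminal-adjacent zones of `O` (`InteriorBlue`, `interiorSet`);
the O-CUBE `oCube O = Σ_{X ⊆ B(O)} F(O ∪ X)` (the colouring `O ∪ X` opens the edges of `X`).  mine-3's
CONJECTURE (O-CUBE) — `0 ≤ oCube O` for every `O` — is stated as the Prop `OCubeConj`; its base case `B(O) = ∅` is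
THEOREM R (`oCube_nonneg_of_interior_empty`): when no terminal-adjacent zone has an interior blue edge every such zone
is a singleton, hence rc, and the cube is the single term `F(O) ≥ 0` (`sumF_nonneg_of_rc_zones`, in fact whenever
every terminal-adjacent zone is rc).  NOT claimed: (O-CUBE) itself (the open core of ROW C-041, C-041.md §5 / §10).
-/

namespace PercRepro

namespace MultiGraph

open Finset ZonePort

variable {V E : Type*} {G : MultiGraph V E}

section OCube

variable [Fintype V] [Fintype E] [DecidableEq E] (a b c : V)

/-- `F(O)`: the sum of the Good-degree weights over all sources with bare colouring `O`. -/
noncomputable def sumF (G : MultiGraph V E) (a b c : V) (O : Config E) : ℤ :=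
  ∑ S ∈ G.srcSetO a b c O, G.gdWeight a b c S

/-- An interior blue edge of `O`: a blue bare edge inside a terminal-adjacent zone. -/
def InteriorBlue (G : MultiGraph V E) (a b : V) (O : Config E) (e : E) : Prop :=
  G.Bare a b e ∧ O e = false ∧ ∃ u, (∃ e', G.Joins e' u a ∨ G.Joins e' u b) ∧ G.BlueBareConn a b O u (G.fst e)

open Classical in
/-- `B(O)`, as a finite set. -/
noncomputable def interiorSet (G : MultiGraph V E) (a b : V) (O : Config E) : Finset E :=
  univ.filter fun e => G.InteriorBlue a b O e

/-- The colouring `O ∪ X`: the edges of `X` opened (red). -/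
def rcOpenEdges (O : Config E) (X : Finset E) : Config E := fun e => O e || decide (e ∈ X)

open Classical in
/-- The O-cube sum `Σ_{X ⊆ B(O)} F(O ∪ X)`. -/
noncomputable def oCube (G : MultiGraph V E) (a b c : V) (O : Config E) : ℤ :=
  ∑ X ∈ (G.interiorSet a b O).powerset, G.sumF a b c (rcOpenEdges O X)

/-- **mine-3's CONJECTURE (O-CUBE)** (C-041.md §5 (b)–(c)): the principal O-cube sum is nonnegative for every
bare colouring. -/
def OCubeConj (G : MultiGraph V E) (a b c : V) : Prop := ∀ O : Config E, 0 ≤ G.oCube a b c O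

omit [Fintype V] [Fintype E] [DecidableEq E] in
/-- A zone with no interior blue edge is a singleton: the converse direction for the blue-walk step. -/
theorem eq_of_blueBareConn_of_interior_empty {O : Config E} (hB : ∀ e, ¬ G.InteriorBlue a b O e) {u w : V}
    (hu : ∃ e, G.Joins e u a ∨ G.Joins e u b) (hw : G.BlueBareConn a b O u w) : w = u := by
  induction hw with
  | refl => rfl
  | @tail x y _ hxy ih =>
    exfalso
    obtain ⟨e, he, hO, hj⟩ := hxy
    apply hB e
    refine ⟨he, hO, u, hu, ?_⟩
    rw [ih] at hj
    rcases hj with ⟨h1, _⟩ | ⟨h1, h2⟩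
    · rw [h1]
      exact BlueBareConn.refl a b O u
    · rw [h1]
      exact BlueBareConn.single ⟨e, he, hO, Or.inr ⟨h1, h2⟩⟩

omit [Fintype E] [DecidableEq E] in
/-- Without interior blue edges, a terminal-adjacent zone is a singleton, hence rc. -/
theorem rc_of_interior_empty {O : Config E} (hB : ∀ e, ¬ G.InteriorBlue a b O e) {u : V}
    (hu : ∃ e, G.Joins e u a ∨ G.Joins e u b) : G.Rc a b O u := by
  intro x hx y hy
  rw [mem_zone] at hx hy
  rw [eq_of_blueBareConn_of_interior_empty a b hB hu hx, eq_of_blueBareConn_of_interior_empty a b hB hu hy]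

open Classical in
/-- **`F(O) ≥ 0` whenever every terminal-adjacent zone of `O` is rc** (THEOREM R). -/
theorem sumF_nonneg_of_rc_zones (hca : c ≠ a) (hcb : c ≠ b) (hne : a ≠ b) {O : Config E}
    (hO : ∀ u, (∃ e, G.Joins e u a ∨ G.Joins e u b) → G.Rc a b O u) : 0 ≤ G.sumF a b c O :=
  sum_goodDegree_nonneg_of_rc_zones a b c hca hcb hne hO

omit [Fintype V] in
open Classical in
/-- With `B(O) = ∅` the O-cube is the single term `F(O)`. -/
theorem oCube_eq_sumF_of_interior_empty {O : Config E} (hB : ∀ e, ¬ G.InteriorBlue a b O e) :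
    G.oCube a b c O = G.sumF a b c O := by
  have hset : G.interiorSet a b O = ∅ := by
    rw [Finset.eq_empty_iff_forall_notMem]
    intro e he
    unfold interiorSet at he
    rw [mem_filter] at he
    exact hB e he.2
  unfold oCube
  rw [hset, Finset.powerset_empty, Finset.sum_singleton]
  congr 1
  funext e
  unfold rcOpenEdges
  simp

open Classical in
/-- **THE BASE CASE OF (O-CUBE) IS THEOREM R** (C-041.md §5 (b): «THEOREM R as its base case `B(O) = ∅`»): with no
interior blue edge in a terminal-adjacent zone, `0 ≤ oCube O`. -/
theorem oCube_nonneg_of_interior_empty (hca : c ≠ a) (hcb : c ≠ b) (hne : a ≠ b) {O : Config E}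
    (hB : ∀ e, ¬ G.InteriorBlue a b O e) : 0 ≤ G.oCube a b c O := by
  rw [oCube_eq_sumF_of_interior_empty a b c hB]
  exact sumF_nonneg_of_rc_zones a b c hca hcb hne fun u hu => rc_of_interior_empty a b hB hu

end OCube

end MultiGraph

end PercRepro
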